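import Mathlib
import Literature.NumberTheory.LFunctions.Zhang2022.TypedSection15C
import Literature.NumberTheory.LFunctions.Zhang2022.Section15BStep15u035
import Literature.NumberTheory.LFunctions.Zhang2022.Section3SigmaSplitting
import Literature.NumberTheory.LFunctions.Zhang2022.SkeletonWindowPowers
import HarnessLib

/-!
# Zhang (2022) §15 p. 87: the deduction "By (15.19)–(15.21) and Lemma 15.1 we obtain (15.22)" as a
# kernel-checked edge, at the `χ`-absorbed coefficient reading of record (`inputs15ABchi`)

Topic `Literature/NumberTheory/LFunctions/Zhang2022` (Landau–Siegel audit tree; verdict-neutral).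
Y. Zhang, *Discrete mean estimates and the Landau–Siegel zero*, arXiv:2211.02515v1 (2022)
[Zhang2022LandauSiegel] — **an unrefereed manuscript under adjudication; nothing in this file asserts
any claim of the manuscript, or anything about its Theorems 1–2 / Landau–Siegel zeros.** ZHANG-L
discharge lane (WP15), leaf `h15_22 : Typed.Section15C.Eq15_22 c′ Typed.Section15C.inputs15ABchi` of
`Skeleton.theorem1_of_leaves_v19`; DAG node `Z22:(15.22)` [Z22 §15 p. 87, (15.22), tex L4306–L4307]:

> By (15.19)–(15.21) and Lemma 15.1 we obtain
> `𝒮₁ⱼ = 𝔢ⱼ𝓜₁(1,1;1−βⱼ) Σ_{n∈𝒩(𝒬), n<T} χ(n)τ₂(n)ϖ₁ⱼ(n)/n + O(1/𝓛)`, `1 ≤ j ≤ 3`.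

This file proves the DEDUCTION, with every input a typed node of the tree (or a tree theorem):

* (15.19) and (15.20) enter through the tree edges `Typed.Section15B.eq15_19_of_eq15_18`,
  `eq15_20_chi_of_eq15_18` (both ⇐ (15.18), `Typed.Section15B.Eq15_18 c′`, hypothesis `h18`);
* the Rankin cut `n₁ < T` is the typed inline claim `Typed.Section15B.Inline15_Rankin c′ bChi`
  (hypothesis `hR`, error `O(ε₁) = O(exp(−c𝓛^{1/10}))`);
* (15.21) is used on the ROUGH inner variable `n` (all prime factors `≥ D⁴`) on the whole support of
  `b(n₁n)`, i.e. for `n < P` — hypothesis `h21`, the typed `Typed.Section15B.Eq15_21 c′` with its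
  printed range `n < PT⁻³` widened to `n < P` (the range the deduction actually needs; the local-ratio
  proof of §15.u040 is range-free);
* Lemma 15.1 in the `χ`-reading of record `Skeleton.Lemma151ChiR c′` (rate `α₁ = α log T`,
  hypothesis `h151`; tree edge `Skeleton.lemma151ChiR_of_partsR` from the Appendix-B parts);
* the size input `Σ_{n₁∈𝒩(𝒬), n₁<T} τ₂(n₁)|ϖ₁ⱼ(n₁)|/n₁ ≪ 𝓛⁶` (hypothesis `hS`; any exponent `≤ 6`
  suffices since `α₁𝓛⁶ = π𝓛^{−1.9}`) — the majorant over the `𝒬`-smooth numbers that the same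
  paragraph uses for §15.u050;
* tree theorems: `|b(n)| ≪ τ₂(n)` and the support of `b` ((15.2), `Typed.Section15A.eq15_2_holds`),
  `𝓜₁(1,1;1−βⱼ) ≪ 1` (§15.u035, `Typed.Section15B.step15_u035_holds`), `Σ_{n≤Y} τ₂(n)²/n ≤ (1+log Y)⁴`
  (`sum_card_divisors_pow_div_le_log_pow`).

Bookkeeping: with `A(n₁) := Σ_{(n,𝒬)=1} b_χ(n₁n)ϖ₁ⱼ(n)/n`,
`𝒮₁ⱼ − 𝔢ⱼ𝓜₁Σ_{n₁<T}χτ₂ϖ₁ⱼ/n₁ = 𝓜₁·[Rankin tail] + 𝓜₁Σ_{n₁<T, n₁∈𝒩(𝒬)} ϖ₁ⱼ(n₁)n₁⁻¹(A(n₁) − χ(n₁)τ₂(n₁)𝔢ⱼ)`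
and `A(n₁) − χ(n₁)τ₂(n₁)𝔢ⱼ = [Lemma 15.1] + Σ b_χ(n₁n)(ϖ₁ⱼ(n) − χ(n)ϱ*ⱼ(n))/n`, of norm
`≤ C α₁ τ₂(n₁) + C′D^{−c}𝓛³⁶τ₂(n₁)`; so the total is `≪ ε₁ + α₁𝓛⁶ + D^{−c}𝓛⁴² ≪ 1/𝓛`.

WHAT THIS IS NOT: a proof of (15.18), of the Rankin step, of (15.21), of Lemma 15.1 or of the smooth
majorant (they remain hypotheses here; the leaf closes when they are discharged), nor any claim about
Theorems 1–2 of the manuscript.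

## References
* Y. Zhang, arXiv:2211.02515v1 (2022), §15 pp. 85–87, (15.18)–(15.22), Lemma 15.1.
  [cite: Zhang2022LandauSiegel, §15 (15.22) p.87]
-/

noncomputable section

open Complex Real ComplexConjugate Finset
open Literature.NumberTheory.LFunctions.Zhang2022.Skeleton
open Literature.NumberTheory.LFunctions.Zhang2022.Typed

namespace Literature.NumberTheory.LFunctions.Zhang2022.Typed.Section15C

/-! ## 1. Elementary eventual inequalities -/

section Eventual

/-- `d(mn) ≤ d(m)d(n)`. [folklore] -/
private theorem card_divisors_mul_le (m n : ℕ) :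
    (m * n).divisors.card ≤ m.divisors.card * n.divisors.card := by
  rw [Nat.divisors_mul]
  exact Finset.card_mul_le

/-- `x^k ≤ k!^{?}`-type absorption: for `x ≥ 0`, `x ^ k * exp (-x) ≤ (k+1)!`, from
`x^{k+1}/(k+1)! ≤ exp x`. [folklore] -/
private theorem pow_mul_exp_neg_le (k : ℕ) {x : ℝ} (hx : 1 ≤ x) :
    x ^ k * Real.exp (-x) ≤ (Nat.factorial (k + 1) : ℝ) := by
  have h := Real.pow_div_factorial_le_exp x (by linarith) (k + 1)
  have hf : (0 : ℝ) < Nat.factorial (k + 1) := by exact_mod_cast Nat.factorial_pos _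
  rw [div_le_iff₀ hf] at h
  have hxk : x ^ k ≤ x ^ (k + 1) := by
    rw [pow_succ]; exact le_mul_of_one_le_right (by positivity) hx
  rw [Real.exp_neg, mul_inv_le_iff₀ (Real.exp_pos _)]
  rw [mul_comm] at h
  exact hxk.trans h

/-- **`ε₁ = exp(−c𝓛^{1/10})` is `o(1/𝓛)`**: for `c > 0` and any `C`, for all large `D`,
`C·exp(−c𝓛^{1/10}) ≤ 1/𝓛`. [cite: Zhang2022LandauSiegel, §15 p. 86] -/
theorem eps1_le_inv_ell {c : ℝ} (hc : 0 < c) (C : ℝ) :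
    ∃ D₁ : ℕ, ∀ D : ℕ, D₁ ≤ D → C * Real.exp (-c * ell D ^ (1 / 10 : ℝ)) ≤ 1 / ell D := by
  -- `M'` = the size `y = 𝓛^{1/10}` must have: `c y ≥ 1` and `c y ≥ |C|·12!/c^10`
  set M' : ℝ := max (1 / c) (|C| * Nat.factorial 12 / c ^ (11 : ℕ)) with hM'
  have hM'0 : 0 < M' := lt_of_lt_of_le (by positivity) (le_max_left _ _)
  obtain ⟨D₁, hD₁⟩ := exists_nat_forall_le_ell (max 1 (M' ^ (10 : ℕ)))
  refine ⟨D₁, fun D hD => ?_⟩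
  have hℓ := hD₁ D hD
  have hℓ1 : 1 ≤ ell D := le_trans (le_max_left _ _) hℓ
  have hℓ0 : 0 < ell D := by linarith
  set y : ℝ := ell D ^ (1 / 10 : ℝ) with hy
  have hy0 : 0 < y := Real.rpow_pos_of_pos hℓ0 _
  have hy10 : y ^ (10 : ℕ) = ell D := by
    rw [hy, ← Real.rpow_natCast, ← Real.rpow_mul hℓ0.le]; norm_num
  have hyM : M' ≤ y := by
    refine (pow_le_pow_iff_left₀ hM'0.le hy0.le (by norm_num : (10 : ℕ) ≠ 0)).mp ?_
    rw [hy10]; exact le_trans (le_max_right _ _) hℓ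
  set x : ℝ := c * y with hx
  have hx1 : 1 ≤ x := by
    have h1 : 1 / c ≤ y := le_trans (le_max_left _ _) hyM
    rw [div_le_iff₀' hc] at h1; exact h1
  have hx0 : 0 < x := by linarith
  have hxC : |C| * Nat.factorial 12 / c ^ (10 : ℕ) ≤ x := by
    have h1 : |C| * Nat.factorial 12 / c ^ (11 : ℕ) ≤ y := le_trans (le_max_right _ _) hyM
    have h2 := mul_le_mul_of_nonneg_left h1 hc.le
    calc |C| * Nat.factorial 12 / c ^ (10 : ℕ) = c * (|C| * Nat.factorial 12 / c ^ (11 : ℕ)) := by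
          field_simp
      _ ≤ c * y := h2
  have key := pow_mul_exp_neg_le 11 hx1
  -- `C e^{-x} 𝓛 = (C/c^10) x^10 e^{-x} ≤ (|C|/c^10)·12!/x ≤ 1`
  rw [show -c * ell D ^ (1 / 10 : ℝ) = -x by rw [hx, hy]; ring, le_div_iff₀ hℓ0]
  have hcpow : (0 : ℝ) < c ^ (10 : ℕ) := pow_pos hc 10
  calc C * Real.exp (-x) * ell D
      ≤ |C| * Real.exp (-x) * ell D := by gcongr; exact le_abs_self C
    _ = |C| / c ^ (10 : ℕ) * (x ^ (11 : ℕ) * Real.exp (-x)) / x := by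
        rw [← hy10, hx, mul_pow]; field_simp
    _ ≤ |C| / c ^ (10 : ℕ) * (Nat.factorial 12 : ℝ) / x := by gcongr
    _ = (|C| * Nat.factorial 12 / c ^ (10 : ℕ)) / x := by ring
    _ ≤ 1 := by rw [div_le_one hx0]; exact hxC

/-- **`D^{−c}·𝓛^k = o(1/𝓛)`**: for `c > 0`, any `C` and `k`, for all large `D`,
`C·D^{−c}·𝓛^k ≤ 1/𝓛` (`D^{−c} = e^{−c𝓛}`). [cite: Zhang2022LandauSiegel, §15 (15.21) p. 86] -/
theorem rpow_neg_mul_ell_pow_le_inv_ell {c : ℝ} (hc : 0 < c) (C : ℝ) (k : ℕ) :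
    ∃ D₁ : ℕ, ∀ D : ℕ, D₁ ≤ D → C * (D : ℝ) ^ (-c) * ell D ^ k ≤ 1 / ell D := by
  set M' : ℝ := max (1 / c) (|C| * Nat.factorial (k + 3) / c ^ (k + 2)) with hM'
  obtain ⟨D₁, hD₁⟩ := exists_nat_forall_le_ell (max 1 M')
  refine ⟨max D₁ 1, fun D hD => ?_⟩
  have hD1 : 1 ≤ D := le_trans (le_max_right _ _) hD
  have hDpos : (0 : ℝ) < D := by exact_mod_cast hD1
  have hℓ := hD₁ D (le_trans (le_max_left _ _) hD)
  have hℓ1 : 1 ≤ ell D := le_trans (le_max_left _ _) hℓ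
  have hℓ0 : 0 < ell D := by linarith
  have hℓM : M' ≤ ell D := le_trans (le_max_right _ _) hℓ
  set x : ℝ := c * ell D with hx
  have hx1 : 1 ≤ x := by
    have h1 : 1 / c ≤ ell D := le_trans (le_max_left _ _) hℓM
    rw [div_le_iff₀' hc] at h1; exact h1
  have hx0 : 0 < x := by linarith
  have hxC : |C| * Nat.factorial (k + 3) / c ^ (k + 1) ≤ x := by
    have h1 : |C| * Nat.factorial (k + 3) / c ^ (k + 2) ≤ ell D := le_trans (le_max_right _ _) hℓM
    have h2 := mul_le_mul_of_nonneg_left h1 hc.le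
    calc |C| * Nat.factorial (k + 3) / c ^ (k + 1)
        = c * (|C| * Nat.factorial (k + 3) / c ^ (k + 2)) := by rw [pow_succ _ (k + 1)]; field_simp
      _ ≤ c * ell D := h2
  have key := pow_mul_exp_neg_le (k + 2) hx1
  have hDc : (D : ℝ) ^ (-c) = Real.exp (-x) := by
    rw [Real.rpow_def_of_pos hDpos, hx, ell]; ring_nf
  rw [hDc, le_div_iff₀ hℓ0]
  have hcpow : (0 : ℝ) < c ^ (k + 1) := pow_pos hc _
  calc C * Real.exp (-x) * ell D ^ k * ell D
      ≤ |C| * Real.exp (-x) * ell D ^ k * ell D := by gcongr; exact le_abs_self C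
    _ = |C| / c ^ (k + 1) * (x ^ (k + 2) * Real.exp (-x)) / x := by
        rw [hx, mul_pow]; field_simp; ring
    _ ≤ |C| / c ^ (k + 1) * (Nat.factorial (k + 2 + 1) : ℝ) / x := by gcongr
    _ = (|C| * Nat.factorial (k + 3) / c ^ (k + 1)) / x := by ring
    _ ≤ 1 := by rw [div_le_one hx0]; exact hxC

/-- **`α₁𝓛⁶ ≤ π/𝓛`** (`α₁ = α log T = π𝓛^{−7.9}`) once `𝓛 ≥ 1`. [cite: Zhang2022LandauSiegel, §6 p. 12] -/
theorem alpha1_mul_ell_pow_six_le {D : ℕ} (hℓ : 1 ≤ ell D) :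
    alpha1 D * ell D ^ 6 ≤ Real.pi / ell D := by
  have hℓ0 : 0 < ell D := by linarith
  have hα : alpha D = Real.pi / ell D ^ 9 := by rw [alpha, bigP, Real.log_exp]
  have h11 : ell D ^ (1.1 : ℝ) ≤ ell D ^ 2 := by
    calc ell D ^ (1.1 : ℝ) ≤ ell D ^ (2 : ℝ) := Real.rpow_le_rpow_of_exponent_le hℓ (by norm_num)
      _ = ell D ^ 2 := by norm_num
  rw [alpha1, log_bigT, hα]
  rw [div_mul_eq_mul_div, div_mul_eq_mul_div, div_le_div_iff₀ (by positivity) hℓ0]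
  calc Real.pi * ell D ^ (1.1 : ℝ) * ell D ^ 6 * ell D
      ≤ Real.pi * ell D ^ 2 * ell D ^ 6 * ell D := by gcongr
    _ = Real.pi * ell D ^ 9 := by ring

end Eventual



/-! ## 2. The instantiated objects unfold to the owners' objects -/

section Unfold

variable (c' : ℝ) {D : ℕ} [NeZero D] (χ : DirichletCharacter ℂ D)

/-- `ϖ₁ⱼ` field of `inputs15ABchi` = `Typed.Section15B.varpi1`, by `rfl`.
[cite: Zhang2022LandauSiegel, §15 p.85] -/
theorem inputs15ABchi_varpi1 (j n : ℕ) :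
    inputs15ABchi.varpi1 c' χ j n = Section15B.varpi1 c' χ j n := rfl

/-- `𝓜₁` field of `inputs15ABchi` = `Typed.Section15B.calM1`, by `rfl`. [cite: Zhang2022LandauSiegel, §15 p.84] -/
theorem inputs15ABchi_calM1 (d l : ℕ) (s : ℂ) :
    inputs15ABchi.calM1 c' χ d l s = Section15B.calM1 c' χ d l s := rfl

/-- `𝒮₁ⱼ` field of `inputs15ABchi` = `Typed.Section15B.calS1` at the χ-absorbed coefficients `bChi`,
by `rfl`. [cite: Zhang2022LandauSiegel, §15 p.85] -/
theorem inputs15ABchi_calS1 (j : ℕ) :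
    inputs15ABchi.calS1 c' χ j = Section15B.calS1 c' χ (Section15A.bChi D χ) j := rfl

end Unfold

/-! ## 3. The edge (15.19)–(15.21) + Lemma 15.1 ⇒ (15.22) -/

section Edge

/-- The (15.21) error inside one inner sum (pointwise bookkeeping): with `|b(m)| ≤ C_b τ₂(m)`,
`‖ϖ(n) − ρ(n)‖ ≤ C₁τ₂(n)E` on `R ⊆ [1, N)` and `Σ_{n<N} τ₂(n)²/n ≤ B`,
`‖Σ_{n∈R} b_χ(n₁n)(ϖ(n) − ρ(n))/n‖ ≤ |C_b||C₁|·E·B·τ₂(n₁)` (`τ₂(n₁n) ≤ τ₂(n₁)τ₂(n)`).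
[cite: Zhang2022LandauSiegel, §15 (15.21) p.86] -/
private theorem norm_sum_bChi_mul_sub_le {D : ℕ} (χ : DirichletCharacter ℂ D) (ϖ ρ : ℕ → ℂ)
    {Cb C₁ E B : ℝ} {R : Finset ℕ} {N : ℕ} (hR : R ⊆ Finset.Ico 1 N)
    (hb : ∀ m : ℕ, ‖bcoef D m‖ ≤ Cb * (m.divisors.card : ℝ)) (hE : 0 ≤ E)
    (h21 : ∀ n ∈ R, ‖ϖ n - ρ n‖ ≤ C₁ * (n.divisors.card : ℝ) * E)
    (hτ : ∑ n ∈ Finset.Ico 1 N, (n.divisors.card : ℝ) ^ 2 / n ≤ B) (n₁ : ℕ) :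
    ‖∑ n ∈ R, Section15A.bChi D χ (n₁ * n) * (ϖ n - ρ n) / (n : ℂ)‖ ≤
      |Cb| * |C₁| * E * B * n₁.divisors.card := by
  have hterm : ∀ n ∈ R, ‖Section15A.bChi D χ (n₁ * n) * (ϖ n - ρ n) / (n : ℂ)‖ ≤
      |Cb| * |C₁| * E * n₁.divisors.card * ((n.divisors.card : ℝ) ^ 2 / n) := by
    intro n hn
    have hn1 : 1 ≤ n := (Finset.mem_Ico.mp (hR hn)).1
    have hn0 : (0 : ℝ) < n := by exact_mod_cast hn1
    have hbn : ‖Section15A.bChi D χ (n₁ * n)‖ ≤ |Cb| * (n₁.divisors.card * n.divisors.card) := by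
      have h1 : ‖bcoef D (n₁ * n)‖ ≤ Cb * ((n₁ * n).divisors.card : ℝ) := hb _
      have h2 : ((n₁ * n).divisors.card : ℝ) ≤ n₁.divisors.card * n.divisors.card := by
        exact_mod_cast card_divisors_mul_le n₁ n
      have eb : Section15A.bChi D χ (n₁ * n) = χ ((n₁ * n : ℕ) : ZMod D) * bcoef D (n₁ * n) := rfl
      calc ‖Section15A.bChi D χ (n₁ * n)‖
          = ‖χ ((n₁ * n : ℕ) : ZMod D)‖ * ‖bcoef D (n₁ * n)‖ := by rw [eb, norm_mul]
        _ ≤ 1 * (Cb * ((n₁ * n).divisors.card : ℝ)) :=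
            mul_le_mul (DirichletCharacter.norm_le_one χ _) h1 (norm_nonneg _) zero_le_one
        _ ≤ |Cb| * ((n₁ * n).divisors.card : ℝ) := by
            rw [one_mul]
            exact mul_le_mul_of_nonneg_right (le_abs_self _) (Nat.cast_nonneg _)
        _ ≤ |Cb| * (n₁.divisors.card * n.divisors.card) :=
            mul_le_mul_of_nonneg_left h2 (abs_nonneg _)
    have hv : ‖ϖ n - ρ n‖ ≤ |C₁| * (n.divisors.card : ℝ) * E := by
      refine (h21 n hn).trans ?_
      gcongr
      exact le_abs_self _
    rw [norm_div, norm_mul, Complex.norm_natCast, div_le_iff₀ hn0]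
    calc ‖Section15A.bChi D χ (n₁ * n)‖ * ‖ϖ n - ρ n‖
        ≤ (|Cb| * (n₁.divisors.card * n.divisors.card)) * (|C₁| * (n.divisors.card : ℝ) * E) :=
          mul_le_mul hbn hv (norm_nonneg _) (by positivity)
      _ = |Cb| * |C₁| * E * n₁.divisors.card * ((n.divisors.card : ℝ) ^ 2 / n) * n := by
          field_simp
  calc ‖∑ n ∈ R, Section15A.bChi D χ (n₁ * n) * (ϖ n - ρ n) / (n : ℂ)‖
      ≤ ∑ n ∈ R, ‖Section15A.bChi D χ (n₁ * n) * (ϖ n - ρ n) / (n : ℂ)‖ := norm_sum_le _ _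
    _ ≤ ∑ n ∈ R, |Cb| * |C₁| * E * n₁.divisors.card * ((n.divisors.card : ℝ) ^ 2 / n) :=
        Finset.sum_le_sum hterm
    _ = |Cb| * |C₁| * E * n₁.divisors.card * ∑ n ∈ R, (n.divisors.card : ℝ) ^ 2 / n := by
        rw [Finset.mul_sum]
    _ ≤ |Cb| * |C₁| * E * n₁.divisors.card * ∑ n ∈ Finset.Ico 1 N, (n.divisors.card : ℝ) ^ 2 / n := by
        refine mul_le_mul_of_nonneg_left ?_ (by positivity)
        exact Finset.sum_le_sum_of_subset_of_nonneg hR fun n _ _ => by positivity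
    _ ≤ |Cb| * |C₁| * E * n₁.divisors.card * B := mul_le_mul_of_nonneg_left hτ (by positivity)
    _ = |Cb| * |C₁| * E * B * n₁.divisors.card := by ring

open scoped Classical in
/-- **EDGE `Z22:(15.22)` ⇐ (15.18) [⇒ (15.19), (15.20)] + Rankin + (15.21) (range `n < P`) + Lemma 15.1
(`χ`-reading of record, rate `α₁`) + the smooth majorant `Σ_{n₁∈𝒩(𝒬),n₁<T} τ₂|ϖ₁ⱼ|/n₁ ≪ 𝓛⁶`**, at the
instance `inputs15ABchi` (the leaf `h15_22` of `theorem1_of_leaves_v19`). The chain is the printed one: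
`𝒮₁ⱼ = 𝓜₁(1,1;1−βⱼ)Σₙ b(n)ϖ₁ⱼ(n)/n` (15.19) `= 𝓜₁Σ_{n₁∈𝒩(𝒬)}ϖ₁ⱼ(n₁)/n₁ Σ_{(n,𝒬)=1}b(n₁n)ϖ₁ⱼ(n)/n`
(15.20), the cut `n₁ < T` at cost `O(ε₁)` (Rankin), then on the rough variable `ϖ₁ⱼ(n) = χ(n)ϱ*ⱼ(n) +
O(τ₂(n)D^{−c})` (15.21) and Lemma 15.1 gives `Σ_{(n,𝒬)=1} b(n₁n)χ(n)ϱ*ⱼ(n)/n = χ(n₁)τ₂(n₁)𝔢ⱼ + O(α₁τ₂(n₁))`;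
the error terms sum to `O(𝓜₁·(ε₁ + (α₁ + D^{−c}𝓛³⁶)·Σ_{n₁}τ₂|ϖ₁ⱼ|/n₁)) = O(1/𝓛)`.
[cite: Zhang2022LandauSiegel, §15 (15.22) p.87] -/
theorem eq15_22_chi_of_parts (c' : ℝ)
    (h18 : Section15B.Eq15_18 c')
    (h21 : ∃ c : ℝ, 0 < c ∧ ∃ C : ℝ, ForAllLarge fun D _ χ => AssumptionA D χ →
      ∀ j ∈ ({1, 2, 3} : Finset ℕ), ∀ n : ℕ, 1 ≤ n → (n : ℝ) < bigP D → Nat.Coprime n (frakq D) →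
        ‖Section15B.varpi1 c' χ j n - χ (n : ZMod D) * varrhoStar c' χ j n‖ ≤
          C * (n.divisors.card : ℝ) * (D : ℝ) ^ (-c))
    (hR : Section15B.Inline15_Rankin c' Section15A.bChi)
    (h151 : Lemma151ChiR c')
    (hS : ∃ C : ℝ, ForAllLarge fun D _ χ => AssumptionA D χ → ∀ j ∈ ({1, 2, 3} : Finset ℕ),
      ∑ n ∈ (Finset.Ico 1 ⌈bigT D⌉₊).filter (fun n => n ∈ nset (frakq D)),
        (n.divisors.card : ℝ) * ‖Section15B.varpi1 c' χ j n‖ / n ≤ C * ell D ^ 6) :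
    Eq15_22 c' inputs15ABchi := by
  obtain ⟨c₁, hc₁, C₁, h21F⟩ := h21
  obtain ⟨c₂, hc₂, C₂, hRF⟩ := hR
  obtain ⟨C₃, h151F⟩ := h151
  obtain ⟨C₄, hSF⟩ := hS
  obtain ⟨Cb, hbF⟩ := Section15A.eq15_2_holds
  obtain ⟨c₅, C₅, h35F⟩ := Section15B.step15_u035_holds c'
  have h19F := Section15B.eq15_19_of_eq15_18 c' Section15A.bChi h18
  have h20F := Section15B.eq15_20_chi_of_eq15_18 c' h18
  -- the constant of the `D^{-c}` term and the eventual numerics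
  set K : ℝ := |Cb| * |C₁| * 16 with hK
  obtain ⟨D₆, hD₆⟩ := eps1_le_inv_ell hc₂ (|C₅| * |C₂|)
  obtain ⟨D₇, hD₇⟩ := rpow_neg_mul_ell_pow_le_inv_ell hc₁ (|C₅| * |C₄| * K) 42
  obtain ⟨D₈, hD₈⟩ := exists_nat_forall_le_ell 1
  obtain ⟨D₀, hall⟩ :=
    ((((((h21F.and hRF).and h151F).and hSF).and hbF).and h35F).and h19F).and h20F
  refine ⟨2 + |C₅| * |C₄| * |C₃| * Real.pi, max (max D₀ D₆) (max D₇ D₈),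
    fun D _ χ hD hq hp hA j hj => ?_⟩
  have hD₀ : D₀ ≤ D := le_trans (le_trans (le_max_left _ _) (le_max_left _ _)) hD
  have hD6 : D₆ ≤ D := le_trans (le_trans (le_max_right _ _) (le_max_left _ _)) hD
  have hD7 : D₇ ≤ D := le_trans (le_trans (le_max_left _ _) (le_max_right _ _)) hD
  have hD8 : D₈ ≤ D := le_trans (le_trans (le_max_right _ _) (le_max_right _ _)) hD
  obtain ⟨⟨⟨⟨⟨⟨⟨h21D, hRD⟩, h151D⟩, hSD⟩, hbD⟩, h35D⟩, h19D⟩, h20D⟩ := hall D χ hD₀ hq hp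
  have hℓ1 : 1 ≤ ell D := hD₈ D hD8
  have hℓ0 : 0 < ell D := by linarith
  have e6 := hD₆ D hD6
  have e7 := hD₇ D hD7
  -- names
  set ϖ : ℕ → ℂ := Section15B.varpi1 c' χ j with hϖ
  set M : ℂ := Section15B.calM1 c' χ 1 1 (1 - betaJ c' D j) with hM
  set NP : ℕ := ⌈bigP D⌉₊ with hNP
  set NT : ℕ := ⌈bigT D⌉₊ with hNT
  set Q : ℕ := frakq D with hQ
  set R : Finset ℕ := (Finset.Ico 1 NP).filter (fun n => Nat.Coprime n Q) with hRset
  set ST : Finset ℕ := (Finset.Ico 1 NT).filter (fun n => n ∈ nset Q) with hST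
  set inner : ℕ → ℂ := fun n₁ => ∑ n ∈ R, Section15A.bChi D χ (n₁ * n) * ϖ n / (n : ℂ) with hinner
  set A : ℂ := ∑ n₁ ∈ (Finset.Ico 1 NP).filter (fun n₁ => n₁ ∈ nset Q),
    ϖ n₁ / (n₁ : ℂ) * inner n₁ with hAdef
  set AT : ℂ := ∑ n₁ ∈ (Finset.Ico 1 NP).filter (fun n₁ => n₁ ∈ nset Q ∧ (n₁ : ℝ) < bigT D),
    ϖ n₁ / (n₁ : ℂ) * inner n₁ with hAT
  -- (15.19), (15.20), Rankin
  have e19 : Section15B.calS1 c' χ (Section15A.bChi D χ) j =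
      M * ∑ n ∈ Finset.Ico 1 NP, Section15A.bChi D χ n * ϖ n / (n : ℂ) := h19D hA j hj
  have e20 : ∑ n ∈ Finset.Ico 1 NP, Section15A.bChi D χ n * ϖ n / (n : ℂ) = A := h20D hA j hj
  have eR : ‖A - AT‖ ≤ C₂ * Real.exp (-c₂ * ell D ^ (1 / 10 : ℝ)) := hRD hA j hj
  -- `T ≤ P`, so the Rankin-cut set is `ST`
  have hTP : bigT D ≤ bigP D := by
    rw [bigT, bigP]
    refine Real.exp_le_exp.mpr ?_
    calc ell D ^ (1.1 : ℝ) ≤ ell D ^ (9 : ℝ) := Real.rpow_le_rpow_of_exponent_le hℓ1 (by norm_num)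
      _ = ell D ^ 9 := by norm_num
  have hSTeq : (Finset.Ico 1 NP).filter (fun n₁ => n₁ ∈ nset Q ∧ (n₁ : ℝ) < bigT D) = ST := by
    ext n
    simp only [hST, Finset.mem_filter, Finset.mem_Ico, hNT, hNP, Nat.lt_ceil]
    constructor
    · rintro ⟨⟨h1, -⟩, hn, hT⟩; exact ⟨⟨h1, hT⟩, hn⟩
    · rintro ⟨⟨h1, hT⟩, hn⟩; exact ⟨⟨h1, lt_of_lt_of_le hT hTP⟩, hn, hT⟩
  have eAT : AT = ∑ n₁ ∈ ST, ϖ n₁ / (n₁ : ℂ) * inner n₁ := by rw [hAT, hSTeq]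
  -- the target, unfolded
  have eS : inputs15ABchi.calS1 c' χ j = Section15B.calS1 c' χ (Section15A.bChi D χ) j := rfl
  have eSum : sumInN c' inputs15ABchi χ j =
      ∑ n ∈ ST, χ (n : ZMod D) * (n.divisors.card : ℂ) * ϖ n / (n : ℂ) := by
    rw [sumInN]; rfl
  have eM : inputs15ABchi.calM1 c' χ 1 1 (1 - betaJ c' D j) = M := rfl
  rw [eS, eSum, eM, e19, e20]
  -- `‖M‖ ≤ C₅`
  have hMle : ‖M‖ ≤ |C₅| := by
    have hre : 9 / 10 < (1 - betaJ c' D j).re := by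
      simp only [Complex.sub_re, Complex.one_re, Section15B.betaJ_re]; norm_num
    have h := h35D hA 1 1 le_rfl le_rfl _ hre
    rw [mul_one, Nat.primeFactors_one, Finset.prod_empty, mul_one] at h
    exact h.trans (le_abs_self _)
  -- the error of one inner sum, `n₁ ∈ ST`
  have hlogNP : (1 + Real.log ((NP - 1 : ℕ) : ℝ)) ^ 4 ≤ 16 * ell D ^ 36 := by
    have hP1 : ((NP - 1 : ℕ) : ℝ) ≤ bigP D := by
      have hP0 : 0 ≤ bigP D := (Real.exp_pos _).le
      have h := Nat.ceil_lt_add_one hP0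
      rcases Nat.eq_zero_or_pos NP with h0 | h0
      · rw [h0]; simpa using hP0
      · rw [Nat.cast_sub h0, Nat.cast_one, hNP]; linarith
    have hlog : Real.log ((NP - 1 : ℕ) : ℝ) ≤ ell D ^ 9 := by
      rcases Nat.eq_zero_or_pos (NP - 1) with h0 | h0
      · rw [h0, Nat.cast_zero, Real.log_zero]; positivity
      · calc Real.log ((NP - 1 : ℕ) : ℝ) ≤ Real.log (bigP D) :=
              Real.log_le_log (by exact_mod_cast h0) hP1
          _ = ell D ^ 9 := by rw [bigP, Real.log_exp]
    have h9 : (1 : ℝ) ≤ ell D ^ 9 := one_le_pow₀ hℓ1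
    have hlog0 := Real.log_natCast_nonneg (NP - 1)
    calc (1 + Real.log ((NP - 1 : ℕ) : ℝ)) ^ 4 ≤ (ell D ^ 9 + ell D ^ 9) ^ 4 :=
          pow_le_pow_left₀ (by linarith) (by linarith) 4
      _ = 16 * ell D ^ 36 := by ring
  have hτsum : ∑ n ∈ Finset.Ico 1 NP, ((n.divisors.card : ℝ)) ^ 2 / n ≤ 16 * ell D ^ 36 := by
    have hIco : Finset.Ico 1 NP = Finset.Icc 1 (NP - 1) := by
      ext n; simp only [Finset.mem_Ico, Finset.mem_Icc]; omega
    rw [hIco]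
    exact (sum_card_divisors_pow_div_le_log_pow 2 (NP - 1)).trans hlogNP
  have hDc : 0 ≤ (D : ℝ) ^ (-c₁) := Real.rpow_nonneg (Nat.cast_nonneg D) _
  have hinner : ∀ n₁ ∈ ST, ‖inner n₁ - χ (n₁ : ZMod D) * (n₁.divisors.card : ℂ) * frake j‖ ≤
      (|C₃| * alpha1 D + K * (D : ℝ) ^ (-c₁) * ell D ^ 36) * n₁.divisors.card := by
    intro n₁ hn₁
    have hn₁' := Finset.mem_filter.mp hn₁
    have hn₁Q : n₁ ∈ nset Q := hn₁'.2
    have hn₁T : (n₁ : ℝ) < bigT D := by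
      have := (Finset.mem_Ico.mp hn₁'.1).2; rw [hNT] at this; exact Nat.lt_ceil.mp this
    -- split the inner sum along `ϖ = χϱ* + (ϖ − χϱ*)`
    have hsplit : inner n₁ =
        (∑ n ∈ R, χ ((n₁ * n : ℕ) : ZMod D) * bcoef D (n₁ * n) * χ (n : ZMod D) *
            varrhoStar c' χ j n / (n : ℂ)) +
          ∑ n ∈ R, Section15A.bChi D χ (n₁ * n) * (ϖ n - χ (n : ZMod D) * varrhoStar c' χ j n) /
            (n : ℂ) := by
      rw [hinner, ← Finset.sum_add_distrib]
      refine Finset.sum_congr rfl fun n _ => ?_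
      have eb : Section15A.bChi D χ (n₁ * n) = χ ((n₁ * n : ℕ) : ZMod D) * bcoef D (n₁ * n) := rfl
      rw [eb]
      ring
    have h151n := h151D hA j hj n₁ hn₁Q hn₁T
    -- the (15.21) part
    have h21n : ‖∑ n ∈ R, Section15A.bChi D χ (n₁ * n) *
        (ϖ n - χ (n : ZMod D) * varrhoStar c' χ j n) / (n : ℂ)‖ ≤
        K * (D : ℝ) ^ (-c₁) * ell D ^ 36 * n₁.divisors.card := by
      have hb' : ∀ m : ℕ, ‖bcoef D m‖ ≤ Cb * (m.divisors.card : ℝ) := fun m => by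
        have h1 := hbD.1 m; rwa [MeanSquareMajorant.tau_two_apply] at h1
      have h21' : ∀ n ∈ R, ‖ϖ n - (fun m : ℕ => χ (m : ZMod D) * varrhoStar c' χ j m) n‖ ≤
          C₁ * (n.divisors.card : ℝ) * (D : ℝ) ^ (-c₁) := by
        intro n hn
        have hn' := Finset.mem_filter.mp hn
        have hn1 : 1 ≤ n := (Finset.mem_Ico.mp hn'.1).1
        have hnP : (n : ℝ) < bigP D := by
          have := (Finset.mem_Ico.mp hn'.1).2; rw [hNP] at this; exact Nat.lt_ceil.mp this
        exact h21D hA j hj n hn1 hnP hn'.2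
      have h := norm_sum_bChi_mul_sub_le χ ϖ (fun m : ℕ => χ (m : ZMod D) * varrhoStar c' χ j m)
        (Finset.filter_subset _ _) hb' hDc h21' hτsum n₁
      calc ‖∑ n ∈ R, Section15A.bChi D χ (n₁ * n) *
            (ϖ n - χ (n : ZMod D) * varrhoStar c' χ j n) / (n : ℂ)‖
          ≤ |Cb| * |C₁| * (D : ℝ) ^ (-c₁) * (16 * ell D ^ 36) * n₁.divisors.card := h
        _ = K * (D : ℝ) ^ (-c₁) * ell D ^ 36 * n₁.divisors.card := by rw [hK]; ring
    have h151n' : ‖(∑ n ∈ R, χ ((n₁ * n : ℕ) : ZMod D) * bcoef D (n₁ * n) * χ (n : ZMod D) *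
        varrhoStar c' χ j n / (n : ℂ)) - χ (n₁ : ZMod D) * (n₁.divisors.card : ℂ) * frake j‖ ≤
        |C₃| * alpha1 D * n₁.divisors.card := by
      refine h151n.trans ?_
      have hα1 : 0 ≤ alpha1 D := by
        rw [alpha1, log_bigT]
        exact mul_nonneg (alpha_nonneg D) (Real.rpow_nonneg hℓ0.le _)
      gcongr
      exact le_abs_self _
    rw [hsplit]
    calc ‖(∑ n ∈ R, χ ((n₁ * n : ℕ) : ZMod D) * bcoef D (n₁ * n) * χ (n : ZMod D) *
            varrhoStar c' χ j n / (n : ℂ)) +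
          (∑ n ∈ R, Section15A.bChi D χ (n₁ * n) * (ϖ n - χ (n : ZMod D) * varrhoStar c' χ j n) /
            (n : ℂ)) - χ (n₁ : ZMod D) * (n₁.divisors.card : ℂ) * frake j‖
        = ‖((∑ n ∈ R, χ ((n₁ * n : ℕ) : ZMod D) * bcoef D (n₁ * n) * χ (n : ZMod D) *
            varrhoStar c' χ j n / (n : ℂ)) - χ (n₁ : ZMod D) * (n₁.divisors.card : ℂ) * frake j) +
          ∑ n ∈ R, Section15A.bChi D χ (n₁ * n) * (ϖ n - χ (n : ZMod D) * varrhoStar c' χ j n) /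
            (n : ℂ)‖ := by
          congr 1; ring
      _ ≤ |C₃| * alpha1 D * n₁.divisors.card + K * (D : ℝ) ^ (-c₁) * ell D ^ 36 * n₁.divisors.card :=
          (norm_add_le _ _).trans (add_le_add h151n' h21n)
      _ = (|C₃| * alpha1 D + K * (D : ℝ) ^ (-c₁) * ell D ^ 36) * n₁.divisors.card := by ring
  -- the main difference as a sum over `ST`
  have hdiff : AT - frake j * ∑ n ∈ ST, χ (n : ZMod D) * (n.divisors.card : ℂ) * ϖ n / (n : ℂ) =
      ∑ n₁ ∈ ST, ϖ n₁ / (n₁ : ℂ) *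
        (inner n₁ - χ (n₁ : ZMod D) * (n₁.divisors.card : ℂ) * frake j) := by
    rw [eAT, Finset.mul_sum, ← Finset.sum_sub_distrib]
    refine Finset.sum_congr rfl fun n₁ _ => ?_
    ring
  -- sizes
  have hα1 : 0 ≤ alpha1 D := by
    rw [alpha1, log_bigT]; exact mul_nonneg (alpha_nonneg D) (Real.rpow_nonneg hℓ0.le _)
  set L : ℝ := |C₃| * alpha1 D + K * (D : ℝ) ^ (-c₁) * ell D ^ 36 with hL
  have hL0 : 0 ≤ L := by rw [hL, hK]; positivity
  have hSle : ∑ n ∈ ST, (n.divisors.card : ℝ) * ‖ϖ n‖ / n ≤ |C₄| * ell D ^ 6 := by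
    refine (hSD hA j hj).trans ?_
    gcongr; exact le_abs_self _
  have hsum : ‖∑ n₁ ∈ ST, ϖ n₁ / (n₁ : ℂ) *
      (inner n₁ - χ (n₁ : ZMod D) * (n₁.divisors.card : ℂ) * frake j)‖ ≤ L * (|C₄| * ell D ^ 6) := by
    calc ‖∑ n₁ ∈ ST, ϖ n₁ / (n₁ : ℂ) *
          (inner n₁ - χ (n₁ : ZMod D) * (n₁.divisors.card : ℂ) * frake j)‖
        ≤ ∑ n₁ ∈ ST, ‖ϖ n₁ / (n₁ : ℂ) *
          (inner n₁ - χ (n₁ : ZMod D) * (n₁.divisors.card : ℂ) * frake j)‖ := norm_sum_le _ _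
      _ ≤ ∑ n₁ ∈ ST, L * ((n₁.divisors.card : ℝ) * ‖ϖ n₁‖ / n₁) := by
          refine Finset.sum_le_sum fun n₁ hn₁ => ?_
          rw [norm_mul, norm_div, Complex.norm_natCast]
          calc ‖ϖ n₁‖ / (n₁ : ℝ) * ‖inner n₁ - χ (n₁ : ZMod D) * (n₁.divisors.card : ℂ) * frake j‖
              ≤ ‖ϖ n₁‖ / (n₁ : ℝ) * (L * n₁.divisors.card) :=
                mul_le_mul_of_nonneg_left (hinner n₁ hn₁) (by positivity)
            _ = L * ((n₁.divisors.card : ℝ) * ‖ϖ n₁‖ / n₁) := by ring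
      _ = L * ∑ n₁ ∈ ST, (n₁.divisors.card : ℝ) * ‖ϖ n₁‖ / n₁ := by rw [Finset.mul_sum]
      _ ≤ L * (|C₄| * ell D ^ 6) := mul_le_mul_of_nonneg_left hSle hL0
  -- the three eventual sizes
  have s1 : |C₅| * (C₂ * Real.exp (-c₂ * ell D ^ (1 / 10 : ℝ))) ≤ 1 / ell D := by
    calc |C₅| * (C₂ * Real.exp (-c₂ * ell D ^ (1 / 10 : ℝ)))
        ≤ |C₅| * (|C₂| * Real.exp (-c₂ * ell D ^ (1 / 10 : ℝ))) := by
          gcongr; exact le_abs_self _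
      _ = |C₅| * |C₂| * Real.exp (-c₂ * ell D ^ (1 / 10 : ℝ)) := by ring
      _ ≤ 1 / ell D := e6
  have s2 : |C₅| * (|C₃| * alpha1 D) * (|C₄| * ell D ^ 6) ≤ |C₅| * |C₄| * |C₃| * Real.pi / ell D := by
    have h := alpha1_mul_ell_pow_six_le hℓ1
    calc |C₅| * (|C₃| * alpha1 D) * (|C₄| * ell D ^ 6)
        = |C₅| * |C₄| * |C₃| * (alpha1 D * ell D ^ 6) := by ring
      _ ≤ |C₅| * |C₄| * |C₃| * (Real.pi / ell D) := by gcongr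
      _ = |C₅| * |C₄| * |C₃| * Real.pi / ell D := by ring
  have s3 : |C₅| * (K * (D : ℝ) ^ (-c₁) * ell D ^ 36) * (|C₄| * ell D ^ 6) ≤ 1 / ell D := by
    calc |C₅| * (K * (D : ℝ) ^ (-c₁) * ell D ^ 36) * (|C₄| * ell D ^ 6)
        = |C₅| * |C₄| * K * (D : ℝ) ^ (-c₁) * ell D ^ 42 := by ring
      _ ≤ 1 / ell D := e7
  -- assemble
  have key : M * A - frake j * M * ∑ n ∈ ST, χ (n : ZMod D) * (n.divisors.card : ℂ) * ϖ n / (n : ℂ) =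
      M * (A - AT) + M * (AT - frake j * ∑ n ∈ ST, χ (n : ZMod D) * (n.divisors.card : ℂ) * ϖ n / (n : ℂ)) := by
    ring
  rw [key, hdiff]
  calc ‖M * (A - AT) + M * ∑ n₁ ∈ ST, ϖ n₁ / (n₁ : ℂ) *
          (inner n₁ - χ (n₁ : ZMod D) * (n₁.divisors.card : ℂ) * frake j)‖
      ≤ ‖M‖ * ‖A - AT‖ + ‖M‖ * ‖∑ n₁ ∈ ST, ϖ n₁ / (n₁ : ℂ) *
          (inner n₁ - χ (n₁ : ZMod D) * (n₁.divisors.card : ℂ) * frake j)‖ := by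
        refine (norm_add_le _ _).trans ?_
        rw [norm_mul, norm_mul]
    _ ≤ |C₅| * (C₂ * Real.exp (-c₂ * ell D ^ (1 / 10 : ℝ))) + |C₅| * (L * (|C₄| * ell D ^ 6)) := by
        gcongr
    _ = |C₅| * (C₂ * Real.exp (-c₂ * ell D ^ (1 / 10 : ℝ))) +
          (|C₅| * (|C₃| * alpha1 D) * (|C₄| * ell D ^ 6) +
            |C₅| * (K * (D : ℝ) ^ (-c₁) * ell D ^ 36) * (|C₄| * ell D ^ 6)) := by rw [hL]; ring
    _ ≤ 1 / ell D + (|C₅| * |C₄| * |C₃| * Real.pi / ell D + 1 / ell D) :=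
        add_le_add s1 (add_le_add s2 s3)
    _ = (2 + |C₅| * |C₄| * |C₃| * Real.pi) / ell D := by ring

end Edge

end Literature.NumberTheory.LFunctions.Zhang2022.Typed.Section15C
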